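import Literature.NumberTheory.Automorphic.UnitaryGroupDiagTraceExplicitWeights
import HarnessLib

/-!
# The ABSORBED adelic orbital family with STABLE-CLASS weights: `μA = a • m`, `a[γ]` = covolumes, and
# `μA[γ] = α(𝒪_st(γ)) • m[γ]` at the regular classes
(Rogawski, *Automorphic Representations of Unitary Groups in Three Variables* (1990), §14.5 pp. 237–238:
`J_{G′}(f′) = Σ_γ a_γ Φ(γ, f′)`, `a_γ = m(G′_γ \ G′_γ(𝔸))`; §5.4 (5.4.1) p. 72; Deitmar–Echterhoff (2014), Thm. 1.5.3)

Topic `NumberTheory/Automorphic`; namespace `Literature.NumberTheory.Automorphic.UnitaryGroup`. THEOREMS ONLY (no definition,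
no instance, no named fact, no `sorry`); imports ★ `UnitaryGroupDiagTraceExplicitWeights`. Row (O10-c5) of the ENGINE T1 line
`F0_T1InnerFormTraceIdentity` (cell `hodgecm-mathlib`, crux H413; F0P3a-plan (g5) RULING #110 (1), SPEC
`F0/P3a/specs/AbsorbedFamilyStableCovolWeight.spec.F0P3a-plan-g5.lean` b668a9e32c5d7f41 — binders and conclusion VERBATIM).

Given an admissible family `m` of adelic orbital measures of the anisotropic `U(H)` (invariant, finite on compacta, non-zero at every
rational class), ★ `exists_covolWeight_diagTrace_eq_finsum_orbitalSum` reads `m[γ] = dν ∕ dt_γ` for unique two-sided Haar measures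
`t_γ = νZ [γ]` on the adelic centralisers and expands `θ_{G′}(F) = Σᶠ_{𝒪_st} 𝒪_st.orbitalSum ([γ] ↦ a[γ] · Φ_m(γ, F))` with the covolume
weights `a[γ] = vol(U(H)(L⁺)_γ \ U(H)(𝔸)_γ ; t_γ) > 0`. ABSORB the weights: `μA [γ] := ENNReal.ofReal a[γ] • m [γ]` is again
admissible, `Φ_{μA}(γ, F) = a[γ] · Φ_m(γ, F)` (`orbitalIntegral_smul_measure`), so `θ_{G′}(F) = Σᶠ_{𝒪_st} 𝒪_st.orbitalSum (Φ_{μA}(·, F))`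
WEIGHT-FREE, with `[γ] ↦ Φ_{μA}(γ, F)` finitely supported (★ `diagTrace_eq_finsum_covol_mul_adelicClassOrbitalIntegral_of_eq`); and under
the STABILITY hypothesis `hstab` (the covolumes agree at `R`-classes of one stable class — the (O10-c4) head) the weight is a function of
the stable class: `μA [γ] = α(𝒪_st(γ)) • m [γ]` for every `R`-class, `α > 0` (`α 𝒪 := a[γ₀]` for any `R`-class `[γ₀] ⊂ 𝒪`, else `1`).

* `adelicClassOrbitalIntegral_ofReal_smul_family` — `Φ_{a • m}([γ], F) = a[γ] · Φ_m([γ], F)` (`a ≥ 0`).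
* **`exists_absorbedFamily_stableCovolWeight`** — the SPEC head.

HC_CM is proved only modulo the 7 printed citations until rung 0 closes.

## References
* J. D. Rogawski, *Automorphic Representations of Unitary Groups in Three Variables*, Ann. of Math. Stud. 123 (1990), §14.5
  pp. 237–238, §5.4 (5.4.1) p. 72 [Rogawski1990].
* A. Deitmar, S. Echterhoff, *Principles of Harmonic Analysis*, 2nd ed. (2014), Thm. 1.5.3 [DeitmarEchterhoff2014].
-/

set_option autoImplicit false

noncomputable section

open _root_.MeasureTheory _root_.MeasureTheory.Measure Set Filter Function NumberField
open _root_.Topology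
open scoped ENNReal NNReal

namespace Literature.NumberTheory.Automorphic

namespace UnitaryGroup

open CompactlySupported Literature.MeasureTheory.Group Literature.NumberTheory.Rogawski1990
open Literature.AlgebraicGeometry.ShimuraVarieties (hermForm)

section Rescale

variable (L : Type) [Field L] [NumberField L] [IsCMField L] (N : ℕ) (H : Matrix (Fin N) (Fin N) L)
  [∀ γ : (cmDatum L N H).Adelic,
    MeasurableSpace ((cmDatum L N H).Adelic ⧸ Subgroup.centralizer ({γ} : Set (cmDatum L N H).Adelic))]

/-- **`Φ_{a • m}([γ], F) = a[γ] · Φ_m([γ], F)`** for a family rescaled classwise by non-negative reals (`ENNReal.ofReal a[γ] • m[γ]`;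
★ `orbitalIntegral_smul_measure`). [cite: Rogawski1990, §5.4 (5.4.1) p. 72] -/
theorem adelicClassOrbitalIntegral_ofReal_smul_family (m : AdelicOrbitalMeasureFamily L N H)
    (a : ConjClasses (cmDatum L N H).Rational → ℝ) (ha : ∀ c, 0 ≤ a c) (F : (cmDatum L N H).Adelic → ℂ) :
    adelicClassOrbitalIntegral L N H (fun c => ENNReal.ofReal (a c) • m c) F =
      fun c => ((a c : ℝ) : ℂ) * adelicClassOrbitalIntegral L N H m F c := by
  funext c
  dsimp only [adelicClassOrbitalIntegral]
  rw [classOrbitalIntegralAlong_eq, classOrbitalIntegralAlong_eq, orbitalIntegral_smul_measure, ENNReal.toReal_ofReal (ha c),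
    Complex.real_smul]

end Rescale

section Main

variable (L : Type) [Field L] [NumberField L] [IsCMField L] (N : ℕ) (H : Matrix (Fin N) (Fin N) L)
  [MeasurableSpace (cmDatum L N H).Adelic] [BorelSpace (cmDatum L N H).Adelic]
  [∀ γ : (cmDatum L N H).Adelic,
    MeasurableSpace ((cmDatum L N H).Adelic ⧸ Subgroup.centralizer ({γ} : Set (cmDatum L N H).Adelic))]
  [∀ γ : (cmDatum L N H).Adelic,
    BorelSpace ((cmDatum L N H).Adelic ⧸ Subgroup.centralizer ({γ} : Set (cmDatum L N H).Adelic))]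
  [hCcl : ∀ γ : (cmDatum L N H).Adelic, IsClosed ((Subgroup.centralizer ({γ} : Set (cmDatum L N H).Adelic) :
    Subgroup (cmDatum L N H).Adelic) : Set (cmDatum L N H).Adelic)]
  (ν : Measure (cmDatum L N H).Adelic) [ν.IsHaarMeasure] [ν.IsMulRightInvariant]
  [∀ γ : (cmDatum L N H).Adelic, MeasurableSpace (↥(Subgroup.centralizer ({γ} : Set (cmDatum L N H).Adelic)) ⧸
    ((cmDatum L N H).quotientSubgroup ⊓ Subgroup.centralizer ({γ} : Set (cmDatum L N H).Adelic)).subgroupOf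
      (Subgroup.centralizer ({γ} : Set (cmDatum L N H).Adelic)))]
  [∀ γ : (cmDatum L N H).Adelic, BorelSpace (↥(Subgroup.centralizer ({γ} : Set (cmDatum L N H).Adelic)) ⧸
    ((cmDatum L N H).quotientSubgroup ⊓ Subgroup.centralizer ({γ} : Set (cmDatum L N H).Adelic)).subgroupOf
      (Subgroup.centralizer ({γ} : Set (cmDatum L N H).Adelic)))]
  [∀ γ : (cmDatum L N H).Adelic, (count : Measure ↥(((cmDatum L N H).quotientSubgroup ⊓
    Subgroup.centralizer ({γ} : Set (cmDatum L N H).Adelic)).subgroupOf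
      (Subgroup.centralizer ({γ} : Set (cmDatum L N H).Adelic)))).IsHaarMeasure]
  (μ : Measure (cmDatum L N H).automorphicQuotient) [(cmDatum L N H).IsAutomorphicMeasure μ]

/-- **(O10-c5) The absorbed family with STABLE-CLASS weights.**  `m` admissible at every rational class; `R` any set of classes («regular»);
`hstab`: for every Haar reading `m [γ] = dν ∕ d(νZ [γ])` the covolumes `vol(U(H)(L⁺)_γ \ U(H)(𝔸)_γ ; νZ [γ])` agree at `R`-classes `[γ], [γ′]` of the
same stable class.  THEN: ONE all-class-admissible family `μA := a • m` (`a [γ]` = the covolume weights of ★ `exists_covolWeight_diagTrace_eq_finsum_orbitalSum`)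
with `Φ_{μA}(·, F)` finitely supported on the rational classes, the weight-free O-expansion `θ_{G′}(F) = Σᶠ_{𝒪_st} 𝒪_st.orbitalSum (Φ_{μA}(·, F))`,
and a POSITIVE function `α` on the stable classes with `μA [γ] = α(𝒪_st(γ)) • m [γ]` at every `R`-class.
[cite: Rogawski1990, §14.5 pp. 237–238; §5.4 (5.4.1) p. 72] [cite: DeitmarEchterhoff2014, Thm. 1.5.3] -/
theorem exists_absorbedFamily_stableCovolWeight
    (hanis : ∀ x : Fin N → L, hermForm (cmConjRingHom L) H x x = 0 → x = 0) (m : AdelicOrbitalMeasureFamily L N H)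
    (hadm : ∀ c : ConjClasses (cmDatum L N H).Rational,
      SMulInvariantMeasure (cmDatum L N H).Adelic _ (m c) ∧ IsFiniteMeasureOnCompacts (m c) ∧ m c ≠ 0)
    (R : ConjClasses (cmDatum L N H).Rational → Prop)
    (hstab : ∀ (νZ : ∀ c : ConjClasses (cmDatum L N H).Rational,
        Measure ↥(Subgroup.centralizer ({(cmDatum L N H).toAdelic (Quotient.out c)} : Set (cmDatum L N H).Adelic)))
      (_ : ∀ c, IsHaarMeasure (νZ c)) (_ : ∀ c, (νZ c).IsMulRightInvariant) (_ : ∀ c, (νZ c).IsInvInvariant),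
      (∀ c, m c = quotientMeasure (Subgroup.centralizer ({(cmDatum L N H).toAdelic (Quotient.out c)} : Set (cmDatum L N H).Adelic))
        (νZ c) (hCcl _) ν) →
      ∀ c c' : ConjClasses (cmDatum L N H).Rational, R c → R c' →
        StableClass.ofConjClass c = StableClass.ofConjClass c' →
        quotientMeasure (((cmDatum L N H).quotientSubgroup ⊓
            Subgroup.centralizer ({(cmDatum L N H).toAdelic (Quotient.out c)} : Set (cmDatum L N H).Adelic)).subgroupOf
            (Subgroup.centralizer ({(cmDatum L N H).toAdelic (Quotient.out c)} : Set (cmDatum L N H).Adelic))) count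
            (isClosed_subgroupOf _ _ ((isClosed_cmDatum_quotientSubgroup L N H).inter (hCcl _))) (νZ c) Set.univ =
          quotientMeasure (((cmDatum L N H).quotientSubgroup ⊓
            Subgroup.centralizer ({(cmDatum L N H).toAdelic (Quotient.out c')} : Set (cmDatum L N H).Adelic)).subgroupOf
            (Subgroup.centralizer ({(cmDatum L N H).toAdelic (Quotient.out c')} : Set (cmDatum L N H).Adelic))) count
            (isClosed_subgroupOf _ _ ((isClosed_cmDatum_quotientSubgroup L N H).inter (hCcl _))) (νZ c') Set.univ) :
    ∃ μA : AdelicOrbitalMeasureFamily L N H,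
      (∀ c : ConjClasses (cmDatum L N H).Rational,
          SMulInvariantMeasure (cmDatum L N H).Adelic _ (μA c) ∧ IsFiniteMeasureOnCompacts (μA c) ∧ μA c ≠ 0) ∧
      (∀ F : C_c((cmDatum L N H).Adelic, ℂ), (Function.support (adelicClassOrbitalIntegral L N H μA F)).Finite) ∧
      (∀ F : C_c((cmDatum L N H).Adelic, ℂ), diagTrace L N H μ ν hanis F =
        ∑ᶠ st : StableClass (cmConjRingHom L) H, st.orbitalSum (adelicClassOrbitalIntegral L N H μA F)) ∧
      ∃ α : StableClass (cmConjRingHom L) H → ℝ, (∀ 𝒪, 0 < α 𝒪) ∧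
        ∀ c : ConjClasses (cmDatum L N H).Rational, R c → μA c = ENNReal.ofReal (α (StableClass.ofConjClass c)) • m c := by
  classical
  obtain ⟨νZ, hνZ, hr, hi, hm, a, ha0, hacov, hθ⟩ :=
    exists_covolWeight_diagTrace_eq_finsum_orbitalSum L N H ν μ hanis m hadm
  -- the absorbed family
  set μA : AdelicOrbitalMeasureFamily L N H := fun c => ENNReal.ofReal (a c) • m c with hμA
  have hΦ : ∀ F : (cmDatum L N H).Adelic → ℂ, adelicClassOrbitalIntegral L N H μA F =
      fun c => ((a c : ℝ) : ℂ) * adelicClassOrbitalIntegral L N H m F c := fun F =>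
    adelicClassOrbitalIntegral_ofReal_smul_family L N H m a (fun c => (ha0 c).le) F
  -- the covolume weights written out (for the class-level finite support)
  have hfun : ∀ F : (cmDatum L N H).Adelic → ℂ, (fun c => ((a c : ℝ) : ℂ) * adelicClassOrbitalIntegral L N H m F c) =
      fun c => (((quotientMeasure (((cmDatum L N H).quotientSubgroup ⊓
          Subgroup.centralizer ({(cmDatum L N H).toAdelic (Quotient.out c)} : Set (cmDatum L N H).Adelic)).subgroupOf
          (Subgroup.centralizer ({(cmDatum L N H).toAdelic (Quotient.out c)} : Set (cmDatum L N H).Adelic))) count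
          (isClosed_subgroupOf _ _ ((isClosed_cmDatum_quotientSubgroup L N H).inter (hCcl _))) (νZ c) Set.univ).toReal :
          ℝ) : ℂ) * adelicClassOrbitalIntegral L N H m F c := fun F =>
    funext fun c => by rw [hacov c]
  refine ⟨μA, fun c => ⟨?_, ?_, ?_⟩, fun F => ?_, fun F => ?_, ?_⟩
  · -- invariance of `a[γ] • m[γ]`
    haveI := (hadm c).1
    exact SMulInvariantMeasure.smul (ENNReal.ofReal (a c))
  · -- finite on compacta
    haveI := (hadm c).2.1
    exact IsFiniteMeasureOnCompacts.smul (m c) ENNReal.ofReal_ne_top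
  · -- non-zero
    intro h0
    have h1 : (ENNReal.ofReal (a c) • m c) Set.univ = 0 := by rw [show ENNReal.ofReal (a c) • m c = μA c from rfl, h0]; rfl
    rw [Measure.smul_apply, smul_eq_mul] at h1
    rcases mul_eq_zero.1 h1 with h2 | h2
    · exact absurd h2 (ENNReal.ofReal_pos.2 (ha0 c)).ne'
    · exact (hadm c).2.2 (Measure.measure_univ_eq_zero.1 h2)
  · -- finite support of `[γ] ↦ Φ_{μA}(γ, F)`
    rw [hΦ F, hfun F]
    exact (diagTrace_eq_finsum_covol_mul_adelicClassOrbitalIntegral_of_eq L N H ν μ νZ hanis m hm F).1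
  · -- the weight-free O-expansion
    rw [hΦ F]
    exact (hθ F).2
  · -- the stable-class weight
    refine ⟨fun 𝒪 => if h : ∃ c, R c ∧ StableClass.ofConjClass c = 𝒪 then a h.choose else 1, fun 𝒪 => ?_, fun c hc => ?_⟩
    · dsimp only
      by_cases h : ∃ c, R c ∧ StableClass.ofConjClass c = 𝒪
      · rw [dif_pos h]; exact ha0 _
      · rw [dif_neg h]; exact one_pos
    · have h : ∃ c', R c' ∧ StableClass.ofConjClass c' = StableClass.ofConjClass c := ⟨c, hc, rfl⟩
      dsimp only
      rw [dif_pos h]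
      -- the covolumes agree inside a stable class at `R`-classes
      have hcov := hstab νZ hνZ hr hi hm h.choose c h.choose_spec.1 hc h.choose_spec.2
      have ha : a h.choose = a c := by rw [hacov, hacov, hcov]
      rw [ha]

end Main

end UnitaryGroup

end Literature.NumberTheory.Automorphic
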